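import Mathlib
import Literature.Combinatorics.Hinz2018.OliveNotStronglySquareFree

/-!
# Hinz–Klavžar–Petr 2018, Ch. 2 §2.1.1 and Exercise 2.4: squares of `h` lift to squares of `o`

Source: A. M. Hinz, S. Klavžar, C. Petr, *The Tower of Hanoi — Myths and Maths* (2nd ed.,
Birkhäuser 2018), Ch. 2 §2.1.1 «More square-free sequences» (p. 98) with Exercise 2.4 (p. 160)
and its hint (Ch. 9). [cite: HinzKlavzarPetr2018, Ch. 2 §2.1.1 p. 98 and Exercise 2.4 p. 160]

THE ITEM. Hinz's triple sequence `h_m = (o_{3m-2}, o_{3m-1}, o_{3m})` (the sibling's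
`oliveTriple`) reads the Olive sequence `o` (the sibling's `olive`, positions `1, 2, …`) in
consecutive blocks of three. The book uses this in one direction for plain squares — `h`,
«which is square-free, for otherwise the sequence o would contain a square as well.» (typed by
the sibling as `oliveTriple_squareFree`) — and its hint for Exercise 2.4,
«Exercise 2.4 Hint: Start with h.», rests on the same transfer for ABELIAN squares: an abelian
square of `h` at position `i` of length `L` is an abelian square of `o` at position `3i - 2` of
length `3L`, because the `o`-block of length `3L` starting at `3i - 2` is the concatenation of
the triples `h_i, …, h_{i+L-1}` and `List.Perm` is preserved under `List.flatMap`. The sibling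
`OliveNotStronglySquareFree` decided the instance `(4, 6) ↦ (10, 18)` by the kernel and left
the general lift in words (its NOT TYPED list); this file proves it for all `i ≥ 1` and `L`.

WHAT IS TYPED (6 theorems, no definition, no named fact):
* `block_eq_flatMap_triples`, `perm_of_triples_perm` — for ANY sequence `a : ℕ → α` read in
  triples `(a_{3m-2}, a_{3m-1}, a_{3m})`: the block `a_{3i-2}, …, a_{3i-2+3L-1}` is the
  `flatMap` of the triples `m = i, …, i+L-1` (induction on `L`), hence an abelian square of the
  triple sequence at `(i, L)` is an abelian square of `a` at `(3i - 2, 3L)` (`List.Perm` is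
  preserved under `List.flatMap`) — the logic of the hint, stated once for all sequences;
* `olive_block_eq_flatMap` — the instance for `o` and `h = oliveTriple`;
* `olive_blocks_eq_of_oliveTriple_blocks_eq` — equal `h`-blocks give equal `o`-blocks (the
  plain-square direction of the book's sentence, in block-list form; the sibling's
  `oliveTriple_squareFree` is its contrapositive reading through the named fact
  `OliveSquareFree`);
* `olive_perm_of_oliveTriple_perm` — THE ABELIAN LIFT for `h` and `o`: if the block
  `h_{i+L}, …, h_{i+2L-1}` is a permutation of `h_i, …, h_{i+L-1}`, then
  `o_{3i-2+3L}, …, o_{3i-2+6L-1}` is a permutation of `o_{3i-2}, …, o_{3i-2+3L-1}` (stated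
  second-block-first, the clause order of the tree's `ChapterOneExercises.SeqStronglySquareFree`;
  at `(4, 6)` it is the sibling's decided instance `(10, 18)`, and with the sibling's
  `exercise_2_4_h` it re-derives its `exercise_2_4_o` — neither restated here);
* `olive_abelianSquare_not_all_lifted` — OUR kernel observation, not a claim of the book: the
  converse transfer fails — `o`'s earliest abelian square `(5, 9)` (the sibling's
  `olive_abelianSquare`) does not start at a position of the form `3i - 2`.

TREE BEFORE THIS FILE (used by name, not restated): `olive`, `oliveTriple`
(`PerfectToPerfect`); `olive_abelianSquare`, `oliveTriple_abelianSquare`, `exercise_2_4_h`,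
`exercise_2_4_o`, `olive_abelianSquare_of_triples` (`OliveNotStronglySquareFree`);
`List.Perm.flatMap_right` (Mathlib).

NOT TYPED: the Thue sequence over `{a, b, c}` of §2.1.1; the treatments of [197] and [6]; a
characterisation of which abelian squares of `o` come from `h`.
-/

namespace Literature.Combinatorics.Hinz2018

/-- For any sequence `a` read in consecutive triples `(a_{3m-2}, a_{3m-1}, a_{3m})`
(`m ≥ 1`): the block `a_{3i-2}, …, a_{3i-2+3L-1}` is the concatenation (`flatMap`) of the
triples `m = i, …, i + L - 1` — the bookkeeping behind reading `o` through `h`.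
[cite: HinzKlavzarPetr2018, Ch. 2 §2.1.1 p. 98] -/
theorem block_eq_flatMap_triples {α : Type*} (a : ℕ → α) (i L : ℕ) (hi : 1 ≤ i) :
    ((List.range (3 * L)).map fun j => a (3 * i - 2 + j)) =
      (((List.range L).map fun m =>
          (a (3 * (i + m) - 2), a (3 * (i + m) - 1), a (3 * (i + m)))).flatMap
        fun t => [t.1, t.2.1, t.2.2]) := by
  induction L with
  | zero => simp
  | succ L ih =>
    rw [show 3 * (L + 1) = 3 * L + 1 + 1 + 1 by ring, List.range_succ, List.range_succ,
      List.range_succ, List.range_succ]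
    simp only [List.map_append, List.map_cons, List.map_nil, List.flatMap_append,
      List.flatMap_cons, List.flatMap_nil, List.append_nil, List.append_assoc,
      List.singleton_append, ih]
    rw [show 3 * (i + L) - 2 = 3 * i - 2 + 3 * L by omega,
      show 3 * (i + L) - 1 = 3 * i - 2 + (3 * L + 1) by omega,
      show 3 * (i + L) = 3 * i - 2 + (3 * L + 1 + 1) by omega]
    simp

/-- The hint's logic for any sequence `a` read in triples: an abelian square of the triple
sequence at position `i ≥ 1` of length `L` (second block a `List.Perm` of the first) is an
abelian square of `a` at position `3i - 2` of length `3L`, because `List.Perm` is preserved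
under `List.flatMap`. [cite: HinzKlavzarPetr2018, Ch. 2 Exercise 2.4 p. 160 (hint Ch. 9)] -/
theorem perm_of_triples_perm {α : Type*} (a : ℕ → α) (i L : ℕ) (hi : 1 ≤ i)
    (h : ((List.range L).map fun m =>
        (a (3 * (i + L + m) - 2), a (3 * (i + L + m) - 1), a (3 * (i + L + m)))).Perm
      ((List.range L).map fun m =>
        (a (3 * (i + m) - 2), a (3 * (i + m) - 1), a (3 * (i + m))))) :
    ((List.range (3 * L)).map fun j => a (3 * i - 2 + 3 * L + j)).Perm
      ((List.range (3 * L)).map fun j => a (3 * i - 2 + j)) := by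
  have e1 := block_eq_flatMap_triples a i L hi
  have e2 := block_eq_flatMap_triples a (i + L) L (by omega)
  rw [show 3 * (i + L) - 2 = 3 * i - 2 + 3 * L by omega] at e2
  rw [e1, e2]
  exact h.flatMap_right _

/-- The instance for `o` and `h`: the `o`-block of length `3L` starting at position `3i - 2` is
the concatenation of the triples `h_i, …, h_{i+L-1}` (`h_m = oliveTriple m =
(o_{3m-2}, o_{3m-1}, o_{3m})`). [cite: HinzKlavzarPetr2018, Ch. 2 §2.1.1 p. 98] -/
theorem olive_block_eq_flatMap (i L : ℕ) (hi : 1 ≤ i) :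
    ((List.range (3 * L)).map fun j => olive (3 * i - 2 + j)) =
      (((List.range L).map fun m => oliveTriple (i + m)).flatMap
        fun t => [t.1, t.2.1, t.2.2]) := by
  simpa [oliveTriple] using block_eq_flatMap_triples olive i L hi

/-- The plain-square direction in block form («which is square-free, for otherwise the
sequence o would contain a square as well.»): if the `h`-blocks `h_{i+L}, …, h_{i+2L-1}` and
`h_i, …, h_{i+L-1}` are equal, so are the `o`-blocks of length `3L` at `3i - 2 + 3L` and at
`3i - 2`. (The sibling's `oliveTriple_squareFree` is the contrapositive, read through the named
fact `OliveSquareFree`.) [cite: HinzKlavzarPetr2018, Ch. 2 §2.1.1 p. 98] -/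
theorem olive_blocks_eq_of_oliveTriple_blocks_eq (i L : ℕ) (hi : 1 ≤ i)
    (h : ((List.range L).map fun j => oliveTriple (i + L + j)) =
      ((List.range L).map fun j => oliveTriple (i + j))) :
    ((List.range (3 * L)).map fun j => olive (3 * i - 2 + 3 * L + j)) =
      ((List.range (3 * L)).map fun j => olive (3 * i - 2 + j)) := by
  have e1 := olive_block_eq_flatMap i L hi
  have e2 := olive_block_eq_flatMap (i + L) L (by omega)
  rw [show 3 * (i + L) - 2 = 3 * i - 2 + 3 * L by omega] at e2
  rw [e1, e2, h]

/-- THE ABELIAN LIFT behind the hint «Exercise 2.4 Hint: Start with h.»: an abelian square of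
`h` at position `i ≥ 1` of length `L` — the block `h_{i+L}, …, h_{i+2L-1}` a permutation of
`h_i, …, h_{i+L-1}` — is an abelian square of `o` at position `3i - 2` of length `3L`, since
`List.Perm` is preserved under `List.flatMap`.
[cite: HinzKlavzarPetr2018, Ch. 2 Exercise 2.4 p. 160 (hint Ch. 9); §2.1.1 p. 98] -/
theorem olive_perm_of_oliveTriple_perm (i L : ℕ) (hi : 1 ≤ i)
    (h : ((List.range L).map fun j => oliveTriple (i + L + j)).Perm
      ((List.range L).map fun j => oliveTriple (i + j))) :
    ((List.range (3 * L)).map fun j => olive (3 * i - 2 + 3 * L + j)).Perm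
      ((List.range (3 * L)).map fun j => olive (3 * i - 2 + j)) := by
  simpa [oliveTriple] using perm_of_triples_perm olive i L hi (by simpa [oliveTriple] using h)

/-- Our kernel observation, not a claim of the book: the converse transfer fails — not every
abelian square of `o` is the lift of one of `h`. The earliest abelian square of `o`, at
position `5` of length `9` (the sibling's `olive_abelianSquare`), does not start at a position
of the form `3i - 2` (nor is `5 ≡ 1 (mod 3)`).
[cite: HinzKlavzarPetr2018, Ch. 2 Exercise 2.4 p. 160; §2.1.1 p. 98] -/
theorem olive_abelianSquare_not_all_lifted :
    ¬ (∀ i L : ℕ, 1 ≤ i → 1 ≤ L →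
      ((List.range L).map fun j => olive (i + L + j)).Perm
        ((List.range L).map fun j => olive (i + j)) →
      ∃ i' L' : ℕ, 1 ≤ i' ∧ i = 3 * i' - 2 ∧ L = 3 * L') := by
  intro h
  obtain ⟨i', L', hi', hi, -⟩ := h 5 9 (by norm_num) (by norm_num) olive_abelianSquare
  omega

end Literature.Combinatorics.Hinz2018
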